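import Summits.Parity.BatemanHorn.Theses.RoughParitySectors
import Summits.Parity.BatemanHorn.Theorems.RoughParitySectorsRoughParityBalanceSignedSieveOut
import Summits.Parity.BatemanHorn.Theorems.RoughParitySectorsRoughParityBalanceLinearClassSums
import Summits.Parity.BatemanHorn.Theorems.RoughParitySectorsRoughParityBalanceRoughCardLower
import Summits.Parity.BatemanHorn.Theorems.RoughParitySectorsRoughParityBalanceReduction

/-!
# Birth skeleton (BC3) for crux `RoughParitySectors.RoughParityBalance` (stmt-Parity-15627)

Crux (FIXED; concluded BY NAME by `RoughParityBalance_of` below): for every Bateman–Horn system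
`f = (f₁,…,f_k)` and every `δ > 0` there is `U₀` with: for every `U ≥ U₀`, eventually in `x`,
`|2^k · c_odd(x,U) − #R_f(x,U)| ≤ δ · #R_f(x,U)`, where
`R_f(x,U) = {1 ≤ n ≤ x : ∀ i, fᵢ(n) > 0 ∧ no prime p < ⌈x^{deg fᵢ/U}⌉ divides fᵢ(n)}` (jointly rough values)
and `c_odd = #{n ∈ R : ∀ i, Ω(fᵢ(n)) odd}` (the all-odd parity sector).

## The line: Walsh sign-split of the all-odd sector (first-order / higher-order)

Write `λᵢ(n) := (−1)^{Ω(fᵢ(n))}`.  Since `1[Ω odd] = (1 − (−1)^Ω)/2`, EXACTLY (for every finite set and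
every `Ω`-assignment, no arithmetic input)

  `2^k · c_odd = Σ_{S ⊆ [k]} (−1)^{|S|} E_S`,  `E_S(x,U) := Σ_{n ∈ R_f(x,U)} ∏_{i ∈ S} λᵢ(n)`,  `E_∅ = #R`

(`walsh_allOdd`, PROVED below, generic).  Hence `2^k c_odd − #R = Σ_{S ≠ ∅} ± E_S`, and the crux is
EQUIVALENT, system by system, to nothing more than `|Σ_{S≠∅} (−1)^{|S|} E_S| = o(#R)`; it FOLLOWS from the
vanishing of each Walsh coefficient `E_S = o_{U→∞}(#R)` separately.  The skeleton cuts these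
`2^k − 1` coefficients by ORDER and, at first order, by the DEGREE of the member:

* `stub_linearMemberSign`    — `|S| = 1`, `S = {i}`, `deg fᵢ = 1`: `Σ_{n∈R} λ(fᵢ(n)) = o(#R)`.
  THEOREM-GRADE (print): sieve OUT the joint roughness (sign split `E = Σσ·1_sifted`,
  `Λ⁻ ≤ 1_sifted ≤ Λ⁺` with β-sieve weights of level `D = x^{s·deg_max/U}`, so
  `|Σ σ 1_sifted − Σ σ Λ⁻| ≤ Σ(Λ⁺ − Λ⁻) ≪ e^{−s}·xV ≍ e^{−s}·#R` — Fundamental Lemma, dimension ≤ Σ deg fⱼ,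
  `|B(p)| ≤ ω_f(p) < p` by `IsBatemanHornSystem`), then `Σ σ Λ⁻ = Σ_{d<D} λ⁻_d Σ_{c ∈ B_d} Σ_{n ≡ c (d)} λ(a n + b)`
  is a sum of Liouville CLASS SUMS along the linear form `fᵢ = aX + b` over moduli `a·d ≤ x^{1/4}`
  (`U ≥ 4 s deg_max`): `o(x (log x)^{−A})` by Bombieri–Vinogradov for `λ` with `K^{ω(d)}` weights and
  Cauchy–Schwarz — exactly the GHL-side LANDED engine
  `Summit.Parity.GeneralizedHardyLittlewood.Theorems.AbsoluteUpgrade.classSums_le` / `bv_intervals` /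
  `signed_sifted_sum_le` (there for affine forms on an interval; here the co-members `fⱼ`, `j ≠ i`, may be
  NON-linear — their sifted root classes are still residue classes, only `|B(p)|` changes).  `s → ∞` is
  why the statement is `U ≥ U₀(δ)` and not fixed depth.  For `k = 1`, `f = (X)`: Alladi 1982 (Möbius over
  rough integers; tree: `Literature.NumberTheory.Sieve.exists_abs_cell_sub_main_le` + parity-split Buchstab,
  support item `LinearCalibration` (i)).  Size XL in Lean (the BH-side FL with staggered thresholds is banked:
  `Cruxes.RoughValueLaw.IncrementAnchoring.stub_sieveBand`, but its SIGNED form is not).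
* `stub_nonlinearMemberSign` — `|S| = 1`, `deg fᵢ ≥ 2`: `Σ_{n∈R} λ(fᵢ(n)) = o(#R)`.  OPEN — the ATOM of the
  crux: for `k = 1` it IS the crux for that `f` (Walsh with one member: `2c_odd − #R = −E_{{0}}`), i.e.
  one-point Chowla at the arguments of an irreducible polynomial of degree ≥ 2, sifted form ("Alladi along
  f").  By the same sieve-out it reduces to the UNSIFTED Liouville class sums `Σ_{n≤x, n≡c(d)} λ(fᵢ(n))`,
  BV-averaged over `d ≤ x^η` — open for every single `f` of degree ≥ 2 (function-field analogue:
  Sawin–Shusterman 2022; surveys: Teräväinen 2024).  HARDEST stub.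
* `stub_jointSignIndependence` — `|S| ≥ 2`: `Σ_{n∈R} ∏_{i∈S} λ(fᵢ(n)) = o(#R)`: the parities of distinct
  members are asymptotically INDEPENDENT on the jointly rough set.  OPEN: sifted `|S|`-point
  Chowla/Elliott along the sub-tuple; for all-linear `S` this is the species of the GHL-side typed input
  `Summit.Parity.GeneralizedHardyLittlewood.Cruxes.PrimeCellsRelative.SieveOutToChowla.LiouvilleTupleMeanPos`
  (natural-density tuple Chowla with level-`η` averaging; known only log-averaged at two points / odd
  orders: Tao 2016, Tao–Teräväinen 2019, Helfgott–Radziwiłł 2021, Pilatte 2023); with a non-linear member it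
  is mixed polynomial Chowla (FF only).

Composition `roughParityBalance_of_parts` (REAL proof, no sorry): fix `f, δ`; for each of the finitely
many `S ≠ ∅` pick `U₀(S)` for tolerance `δ/2^k` from the stub that owns `S` (`|S| = 1`: by
`IsBatemanHornSystem.natDegree_pos`, `deg fᵢ = 1` or `≥ 2`; `|S| ≥ 2`: the third stub); take
`U₀ = max_S U₀(S)` (`Finset.sup'` over the Fintype `Finset (Fin k)`), intersect the `2^k` eventual sets
(`Filter.eventually_all`), apply `walsh_allOdd`, split off `E_∅ = #R`, and sum:
`|2^k c_odd − #R| ≤ Σ_{S≠∅} |E_S| ≤ 2^k · (δ/2^k) · #R = δ·#R`.  `RoughParityBalance_of : RoughParityBalance`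
feeds it the three stubs.  `k = 0`: no `S ≠ ∅`, the crux reads `|1·#R − #R| ≤ δ#R` — covered by the same
proof (empty sum).

## Why this cut (and not the degree-profile case split of the route's two-layer plan)

The Walsh order is the coordinate in which the KNOWN part separates from the OPEN part: first-order
coefficients of LINEAR members are theorems (BV for `λ`), everything else is Chowla-type.  A `k`-tuple
Dickson system `(X, X+2, …)` needs `stub_linearMemberSign` (provable) + `stub_jointSignIndependence`
(open, GHL-interface); a single `n² + 1` needs only `stub_nonlinearMemberSign`; the route's support item
`LinearCalibration` (i) is the `k = 1`, `f = X` instance of `stub_linearMemberSign`.  No stub is the crux or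
the summit in costume: each first-order stub speaks of ONE member over the JOINTLY rough set of a
`k`-system (not implied by the crux for the 1-system `(fᵢ)`, whose rough set is larger), the joint stub
only of `|S| ≥ 2`; the BC3 probes `stub → RoughParityBalance` and `stub → BatemanHorn` by
`first | exact? | simpa | aesop` FAIL for all three (folder `bc/probe_*.lean`, quoted in `Lines/birth.md`).

## Disproof / negatives / barriers

No `Disproof.lean` exists for this crux (`ledger crux ls stmt-Parity-15627`: no workfiles at registration);
no landed `Theorems/RoughParityBalance/Negative/*`; `ledger negatives --problem Parity` lists only GHL
statements — nothing to honour or import.  Barriers: `Literature.Barriers.Parity.SelbergParityBarrier`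
is the CONTENT of stubs 2–3 (they are parity statements; no sieve-weight argument proves them — the bet of
the route, not evaded here); stub 1 escapes it the classical way (bilinear structure of a LINEAR form:
BV for `λ`); `FordFixedLevelBarrier` / `WeightedSieveLimit` concern the share cruxes, not this one;
`UniformBatemanHornBarrier`: every stub is per-system, `∀ U, ∀ᶠ x` (never uniform in `f` or in `U`).

Foreseen layer 2 (NOT filed; for the line lead): a theorem-grade TRANSFER stub "sieve-out along a BH
system" (`|Σ_{n∈R} σ(n)| ≤ C_f e^{−s} #R + Σ_{d ≤ x^{s deg_max/U} sqfree} Σ_{c ∈ B_d} |Σ_{n≤x, n≡c(d)} σ(n)|`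
for every `±1`-valued `σ`), after which stub 1 = BV for `λ` (landed GHL-side), stub 2 = polynomial
one-point Chowla in APs (BV-mean), stub 3 = tuple Chowla in APs (BV-mean) — all UNSIFTED.

## Reshape c1 (line lead, 2026-08-17): the signed sieve-out transfer is IN and LANDED; stub 1 is a THEOREM

The foreseen layer 2 was run and every theorem-grade piece is now in the tree (all axioms
`{propext, Classical.choice, Quot.sound}`, all `--supports stmt-Parity-15627`):

* E1 `stub_signedClassSieve` — the SIGNED interval residue-class sieve (two non-negative sequences `(1 ± σ)/2` through
  `SieveSequence.fundamental_lemma_uniform_holds`): `Literature.NumberTheory.Sieve.IntervalClassSieve.abs_signedSum_le`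
  (p148419, `Literature/NumberTheory/Sieve/IntervalResidueClassSieveSigned.lean`).
* E2 `stub_signedSieveOut` — signed sieve-out ALONG A BH SYSTEM, uniformly in the weight `|σ| ≤ 1`:
  `|Σ_{n∈R_f(x,U)} σ(n)| ≤ ε#R + Σ_{d ≤ x^θ sqfree} Σ_{c: d∣∏fᵢ(c)} |Σ_{n≤x, n≡c(d)} σ(n)|` for `U ≥ U₁(ε,θ)`, eventually
  (p148644, `Theorems/RoughParitySectorsRoughParityBalanceSignedSieveOut.lean`).
* E3 `stub_linearClassSums` — the class sums of `λ(fᵢ(n)⁺)` for a LINEAR member at level `x^{1/8}` are `≪_A x/(log x)^A`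
  (Bombieri–Vinogradov for `λ` with root-count weights = GHL `AbsoluteUpgrade.classSums_le` along `aX+b`, `F = ∏ fⱼ`)
  (p148599, `Theorems/RoughParitySectorsRoughParityBalanceLinearClassSums.lean`).
* E4 `stub_roughCardLower` — `#R_f(x,U) ≥ x/(log x)^{2S+1}` for `U ≥ U₁`, eventually
  (p148773, `Theorems/RoughParitySectorsRoughParityBalanceRoughCardLower.lean`).
* Stub 1 `stub_linearMemberSign` (registered since birth) — PROVED: `Theorems/RoughParitySectorsRoughParityBalanceReduction.lean`
  (generic `signSum_le_of_classSums` = E2 + E4, fed with E3), together with the BRIDGES `nonlinearMemberSign_of_classSums`,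
  `jointSignIndependence_of_classSums`: each OPEN atom follows from the corresponding UNSIFTED level-`x^θ` class-sum bound
  (one-point Chowla along a non-linear member in progressions on average over moduli `≤ x^θ` with a log-power saving;
  the same for the product weight of ≥ 2 members) — the exact typed inputs the atoms reduce to (stronger than the atoms,
  therefore recorded as bridges and NOT filed as stubs).

What remains registered and `sorry` below are exactly the two OPEN parity atoms, verbatim since birth:
`stub_nonlinearMemberSign` (k = 1, deg ≥ 2: it IS the crux for that `f`; positive density of either sign of `λ(n²+1)`
is already open, Teräväinen 2024 §3.4) and `stub_jointSignIndependence` (sifted tuple Chowla; natural-density two-point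
Chowla is open, only log-averaged versions are known).  `RoughParityBalance_of` closes the crux from them and the theorem
`stub_linearMemberSign` via `roughParityBalance_of_parts`; for ALL-LINEAR (Dickson) systems the crux now rests on
`stub_jointSignIndependence` alone, for a single non-linear polynomial on `stub_nonlinearMemberSign` alone.

Every stub is stated over TREE / Mathlib vocabulary only (the crux's own inline `Finset.filter`
expressions, `ArithmeticFunction.cardFactors`, `IsBatemanHornSystem`), so each can be landed verbatim as
`Summits/Parity/BatemanHorn/Theorems/RoughParitySectorsRoughParityBalance<Stub>.lean` with
`--supports stmt-Parity-15627`.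
-/

namespace Summit.Parity.BatemanHorn.Cruxes.RoughParityBalance.Birth

open scoped BigOperators Topology Classical
open Filter Finset
open Literature.NumberTheory.Sieve
open Summit.Parity.BatemanHorn.Theses.RoughParitySectors (RoughParityBalance)

set_option linter.unusedVariables false

/-! ## The stubs -/

/-! ### Engine stubs (theorem-grade; line lead reshape c1, 2026-08-17): the signed sieve-out transfer

LANDED (imported, no longer declared here): E1 `stub_signedClassSieve` =
`Literature.NumberTheory.Sieve.IntervalClassSieve.abs_signedSum_le` (p148419, Literature/NumberTheory/Sieve/
IntervalResidueClassSieveSigned.lean); E2 `stub_signedSieveOut` (p148644,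
Theorems/RoughParitySectorsRoughParityBalanceSignedSieveOut.lean, this namespace); E3 `stub_linearClassSums`
(p148599, Theorems/RoughParitySectorsRoughParityBalanceLinearClassSums.lean, this namespace); E4 `stub_roughCardLower`
(p148773, Theorems/RoughParitySectorsRoughParityBalanceRoughCardLower.lean, this namespace). -/

/-! ### Stub 1 and the bridges are LANDED (imported): `Theorems/RoughParitySectorsRoughParityBalanceReduction.lean`

`signSum_le_of_classSums` (generic composition E2 + E4), `stub_linearMemberSign` (PROVED, E3), and the bridges
`nonlinearMemberSign_of_classSums` / `jointSignIndependence_of_classSums` for the two open atoms live there, in this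
namespace.  What remains below: the two OPEN atoms (registered stubs, verbatim since birth), the Walsh identity, the
composition, and the crux by name. -/

/-- **Stub 2 — `stub_nonlinearMemberSign` (first-order Walsh coefficient of a NON-LINEAR member; OPEN —
the atom of the crux, HARDEST).**  For every Bateman–Horn system `f`, every index `i` with `deg fᵢ ≥ 2` and
every `δ > 0` there is `U₀` such that for every `U ≥ U₀`, eventually in `x`,
`|Σ_{n ∈ R_f(x,U)} (−1)^{Ω(fᵢ(n))}| ≤ δ · #R_f(x,U)`.  For `k = 1` this is the crux for that `f`
(`2c_odd − #R = −E_{{0}}`): one-point Chowla at the arguments of an irreducible polynomial of degree ≥ 2,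
sifted ("Alladi along f"); by sieve-out it is the BV-mean of the UNSIFTED class sums
`Σ_{n ≤ x, n ≡ c (d)} λ(fᵢ(n))`, `d ≤ x^η`.  Why it might fail: it is the parity bit — a Liouville bias along
the values of one non-linear polynomial persisting as `U → ∞` (none known or expected; FF analogue proved).
[Selberg1952Limitations, SawinShusterman2022, Teravainen2024, Alladi1982Moebius, BombieriAsymptoticSieve1976] -/
theorem stub_nonlinearMemberSign :
    ∀ (k : ℕ) (f : Fin k → Polynomial ℤ), IsBatemanHornSystem f →
      ∀ i : Fin k, 2 ≤ (f i).natDegree → ∀ δ : ℝ, 0 < δ → ∃ U₀ : ℝ, ∀ U : ℝ, U₀ ≤ U →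
        ∀ᶠ x : ℕ in Filter.atTop,
          |∑ n ∈ (Finset.Icc 1 x).filter (fun n : ℕ => ∀ i, 0 < (f i).eval (n : ℤ) ∧
              ∀ p ∈ Finset.range ⌈(x : ℝ) ^ (((f i).natDegree : ℝ) / U)⌉₊,
                p.Prime → ¬ ((p : ℤ) ∣ (f i).eval (n : ℤ))),
              (-1 : ℝ) ^ ArithmeticFunction.cardFactors (((f i).eval (n : ℤ)).toNat)| ≤
            δ * ((((Finset.Icc 1 x).filter (fun n : ℕ => ∀ i, 0 < (f i).eval (n : ℤ) ∧
              ∀ p ∈ Finset.range ⌈(x : ℝ) ^ (((f i).natDegree : ℝ) / U)⌉₊,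
                p.Prime → ¬ ((p : ℤ) ∣ (f i).eval (n : ℤ)))).card : ℕ) : ℝ) := by
  sorry

/-- **Stub 3 — `stub_jointSignIndependence` (higher-order Walsh coefficients, `|S| ≥ 2`; OPEN).**  For every
Bateman–Horn system `f` of `k` polynomials, every `S ⊆ Fin k` with `|S| ≥ 2` and every `δ > 0` there is
`U₀` such that for every `U ≥ U₀`, eventually in `x`,
`|Σ_{n ∈ R_f(x,U)} ∏_{i ∈ S} (−1)^{Ω(fᵢ(n))}| ≤ δ · #R_f(x,U)`: on the jointly rough set the parities
`Ω(fᵢ(n)) mod 2`, `i ∈ S`, are asymptotically independent (sifted `|S|`-point Chowla/Elliott along the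
sub-tuple).  All-linear `S`: the species of the GHL-side typed input `LiouvilleTupleMeanPos` (natural
density, level-`η` mean; log-averaged / odd-order cases known unsifted); `S` with a non-linear member: mixed
polynomial Chowla (function fields only).  Why it might fail: a correlation between the parities of two
members' values surviving infinite sieve depth (e.g. `λ(n)λ(n+2)` biased on twin-rough `n`).
[TaoFMP2016, GreenTao2010, SawinShusterman2022, Teravainen2024, BombieriAsymptoticSieve1976] -/
theorem stub_jointSignIndependence :
    ∀ (k : ℕ) (f : Fin k → Polynomial ℤ), IsBatemanHornSystem f →
      ∀ S : Finset (Fin k), 2 ≤ S.card → ∀ δ : ℝ, 0 < δ → ∃ U₀ : ℝ, ∀ U : ℝ, U₀ ≤ U →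
        ∀ᶠ x : ℕ in Filter.atTop,
          |∑ n ∈ (Finset.Icc 1 x).filter (fun n : ℕ => ∀ i, 0 < (f i).eval (n : ℤ) ∧
              ∀ p ∈ Finset.range ⌈(x : ℝ) ^ (((f i).natDegree : ℝ) / U)⌉₊,
                p.Prime → ¬ ((p : ℤ) ∣ (f i).eval (n : ℤ))),
              ∏ i ∈ S, (-1 : ℝ) ^ ArithmeticFunction.cardFactors (((f i).eval (n : ℤ)).toNat)| ≤
            δ * ((((Finset.Icc 1 x).filter (fun n : ℕ => ∀ i, 0 < (f i).eval (n : ℤ) ∧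
              ∀ p ∈ Finset.range ⌈(x : ℝ) ^ (((f i).natDegree : ℝ) / U)⌉₊,
                p.Prime → ¬ ((p : ℤ) ∣ (f i).eval (n : ℤ)))).card : ℕ) : ℝ) := by
  sorry

/-! ## The Walsh sign-split (PROVED, generic) -/

/-- **Walsh sign-split of the all-odd cell** (exact, for every finite set `R` and every `Ω : ι → α → ℕ`):
`2^{|ι|} · #{n ∈ R : ∀ i, Ω i n odd} = Σ_{S ⊆ ι} (−1)^{|S|} Σ_{n ∈ R} ∏_{i ∈ S} (−1)^{Ω i n}`.
Proof: `∏ᵢ (1 − (−1)^{Ωᵢ(n)})` is `2^{|ι|}` if every `Ωᵢ(n)` is odd and `0` otherwise; expand the product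
(`Finset.prod_one_add`, `Finset.prod_neg`) and exchange the sums. [folklore] -/
theorem walsh_allOdd {ι α : Type*} [Fintype ι] (R : Finset α) (Ω : ι → α → ℕ)
    [DecidablePred fun n => ∀ i, Odd (Ω i n)] :
    (2 : ℝ) ^ Fintype.card ι * ((R.filter (fun n => ∀ i, Odd (Ω i n))).card : ℝ) =
      ∑ S : Finset ι, (-1 : ℝ) ^ S.card * ∑ n ∈ R, ∏ i ∈ S, (-1 : ℝ) ^ (Ω i n) := by
  -- expand the product over `univ`: `∏ᵢ (1 - aᵢ) = Σ_S (−1)^{|S|} ∏_{i∈S} aᵢ`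
  have hexp : ∀ n : α, ∏ i : ι, (1 - (-1 : ℝ) ^ (Ω i n)) =
      ∑ S : Finset ι, (-1 : ℝ) ^ S.card * ∏ i ∈ S, (-1 : ℝ) ^ (Ω i n) := by
    intro n
    have := Finset.prod_one_add (s := (Finset.univ : Finset ι)) (f := fun i => -((-1 : ℝ) ^ (Ω i n)))
    simp only [Finset.powerset_univ] at this
    simp only [sub_eq_add_neg]
    rw [this]
    refine Finset.sum_congr rfl fun S _ => ?_
    rw [Finset.prod_neg]
  -- the left side as the sum over `R` of the pointwise product (`2^{|ι|}` if all odd, else `0`)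
  have hL : (2 : ℝ) ^ Fintype.card ι * ((R.filter (fun n => ∀ i, Odd (Ω i n))).card : ℝ) =
      ∑ n ∈ R, ∏ i : ι, (1 - (-1 : ℝ) ^ (Ω i n)) := by
    rw [mul_comm, ← nsmul_eq_mul, ← Finset.sum_const, Finset.sum_filter]
    refine Finset.sum_congr rfl fun n _ => ?_
    split_ifs with h
    · rw [← Finset.card_univ, ← Finset.prod_const]
      refine Finset.prod_congr rfl fun i _ => ?_
      rw [(h i).neg_one_pow]; norm_num
    · simp only [not_forall, Nat.not_odd_iff_even] at h
      obtain ⟨i, hi⟩ := h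
      exact (Finset.prod_eq_zero (Finset.mem_univ i) (by rw [hi.neg_one_pow]; norm_num)).symm
  rw [hL, Finset.sum_congr rfl fun n _ => hexp n, Finset.sum_comm]
  exact Finset.sum_congr rfl fun S _ => (Finset.mul_sum _ _ _).symm

/-! ## Composition (REAL proof): the three stub STATEMENTS imply the crux BODY -/

/-- **Composition in hypothesis form.**  The statements of `stub_linearMemberSign`,
`stub_nonlinearMemberSign`, `stub_jointSignIndependence` imply the body of
`RoughParitySectors.RoughParityBalance`: per non-empty `S ⊆ Fin k` take the owning stub at tolerance
`δ/2^k`, `U₀ = max_S U₀(S)`, intersect the eventual sets, Walsh (`walsh_allOdd`), split off `E_∅ = #R`,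
triangle inequality over the `2^k − 1 ≤ 2^k` non-empty `S`. -/
theorem roughParityBalance_of_parts
    (h₁ : ∀ (k : ℕ) (f : Fin k → Polynomial ℤ), IsBatemanHornSystem f →
      ∀ i : Fin k, (f i).natDegree = 1 → ∀ δ : ℝ, 0 < δ → ∃ U₀ : ℝ, ∀ U : ℝ, U₀ ≤ U →
        ∀ᶠ x : ℕ in Filter.atTop,
          |∑ n ∈ (Finset.Icc 1 x).filter (fun n : ℕ => ∀ i, 0 < (f i).eval (n : ℤ) ∧
              ∀ p ∈ Finset.range ⌈(x : ℝ) ^ (((f i).natDegree : ℝ) / U)⌉₊,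
                p.Prime → ¬ ((p : ℤ) ∣ (f i).eval (n : ℤ))),
              (-1 : ℝ) ^ ArithmeticFunction.cardFactors (((f i).eval (n : ℤ)).toNat)| ≤
            δ * ((((Finset.Icc 1 x).filter (fun n : ℕ => ∀ i, 0 < (f i).eval (n : ℤ) ∧
              ∀ p ∈ Finset.range ⌈(x : ℝ) ^ (((f i).natDegree : ℝ) / U)⌉₊,
                p.Prime → ¬ ((p : ℤ) ∣ (f i).eval (n : ℤ)))).card : ℕ) : ℝ))
    (h₂ : ∀ (k : ℕ) (f : Fin k → Polynomial ℤ), IsBatemanHornSystem f →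
      ∀ i : Fin k, 2 ≤ (f i).natDegree → ∀ δ : ℝ, 0 < δ → ∃ U₀ : ℝ, ∀ U : ℝ, U₀ ≤ U →
        ∀ᶠ x : ℕ in Filter.atTop,
          |∑ n ∈ (Finset.Icc 1 x).filter (fun n : ℕ => ∀ i, 0 < (f i).eval (n : ℤ) ∧
              ∀ p ∈ Finset.range ⌈(x : ℝ) ^ (((f i).natDegree : ℝ) / U)⌉₊,
                p.Prime → ¬ ((p : ℤ) ∣ (f i).eval (n : ℤ))),
              (-1 : ℝ) ^ ArithmeticFunction.cardFactors (((f i).eval (n : ℤ)).toNat)| ≤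
            δ * ((((Finset.Icc 1 x).filter (fun n : ℕ => ∀ i, 0 < (f i).eval (n : ℤ) ∧
              ∀ p ∈ Finset.range ⌈(x : ℝ) ^ (((f i).natDegree : ℝ) / U)⌉₊,
                p.Prime → ¬ ((p : ℤ) ∣ (f i).eval (n : ℤ)))).card : ℕ) : ℝ))
    (h₃ : ∀ (k : ℕ) (f : Fin k → Polynomial ℤ), IsBatemanHornSystem f →
      ∀ S : Finset (Fin k), 2 ≤ S.card → ∀ δ : ℝ, 0 < δ → ∃ U₀ : ℝ, ∀ U : ℝ, U₀ ≤ U →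
        ∀ᶠ x : ℕ in Filter.atTop,
          |∑ n ∈ (Finset.Icc 1 x).filter (fun n : ℕ => ∀ i, 0 < (f i).eval (n : ℤ) ∧
              ∀ p ∈ Finset.range ⌈(x : ℝ) ^ (((f i).natDegree : ℝ) / U)⌉₊,
                p.Prime → ¬ ((p : ℤ) ∣ (f i).eval (n : ℤ))),
              ∏ i ∈ S, (-1 : ℝ) ^ ArithmeticFunction.cardFactors (((f i).eval (n : ℤ)).toNat)| ≤
            δ * ((((Finset.Icc 1 x).filter (fun n : ℕ => ∀ i, 0 < (f i).eval (n : ℤ) ∧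
              ∀ p ∈ Finset.range ⌈(x : ℝ) ^ (((f i).natDegree : ℝ) / U)⌉₊,
                p.Prime → ¬ ((p : ℤ) ∣ (f i).eval (n : ℤ)))).card : ℕ) : ℝ)) :
    ∀ (k : ℕ) (f : Fin k → Polynomial ℤ), Literature.NumberTheory.Sieve.IsBatemanHornSystem f →
      ∀ δ : ℝ, 0 < δ → ∃ U₀ : ℝ, ∀ U : ℝ, U₀ ≤ U → ∀ᶠ x : ℕ in Filter.atTop,
        |(2 : ℝ) ^ k * (((((Finset.Icc 1 x).filter (fun n : ℕ => ∀ i, 0 < (f i).eval (n : ℤ) ∧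
            ∀ p ∈ Finset.range ⌈(x : ℝ) ^ (((f i).natDegree : ℝ) / U)⌉₊,
              p.Prime → ¬ ((p : ℤ) ∣ (f i).eval (n : ℤ)))).filter (fun n : ℕ =>
            ∀ i, Odd (ArithmeticFunction.cardFactors (((f i).eval (n : ℤ)).toNat)))).card : ℕ) : ℝ) -
          ((((Finset.Icc 1 x).filter (fun n : ℕ => ∀ i, 0 < (f i).eval (n : ℤ) ∧
            ∀ p ∈ Finset.range ⌈(x : ℝ) ^ (((f i).natDegree : ℝ) / U)⌉₊,
              p.Prime → ¬ ((p : ℤ) ∣ (f i).eval (n : ℤ)))).card : ℕ) : ℝ)| ≤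
        δ * ((((Finset.Icc 1 x).filter (fun n : ℕ => ∀ i, 0 < (f i).eval (n : ℤ) ∧
            ∀ p ∈ Finset.range ⌈(x : ℝ) ^ (((f i).natDegree : ℝ) / U)⌉₊,
              p.Prime → ¬ ((p : ℤ) ∣ (f i).eval (n : ℤ)))).card : ℕ) : ℝ) := by
  intro k f hf δ hδ
  have hδ' : (0 : ℝ) < δ / 2 ^ k := by positivity
  -- per-subset bound at tolerance δ/2^k (vacuous for `S = ∅`)
  have key : ∀ S : Finset (Fin k), ∃ U₀ : ℝ, ∀ U : ℝ, U₀ ≤ U → ∀ᶠ x : ℕ in Filter.atTop,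
      S.Nonempty →
        |∑ n ∈ (Finset.Icc 1 x).filter (fun n : ℕ => ∀ i, 0 < (f i).eval (n : ℤ) ∧
            ∀ p ∈ Finset.range ⌈(x : ℝ) ^ (((f i).natDegree : ℝ) / U)⌉₊,
              p.Prime → ¬ ((p : ℤ) ∣ (f i).eval (n : ℤ))),
            ∏ i ∈ S, (-1 : ℝ) ^ ArithmeticFunction.cardFactors (((f i).eval (n : ℤ)).toNat)| ≤
          δ / 2 ^ k * ((((Finset.Icc 1 x).filter (fun n : ℕ => ∀ i, 0 < (f i).eval (n : ℤ) ∧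
            ∀ p ∈ Finset.range ⌈(x : ℝ) ^ (((f i).natDegree : ℝ) / U)⌉₊,
              p.Prime → ¬ ((p : ℤ) ∣ (f i).eval (n : ℤ)))).card : ℕ) : ℝ) := by
    intro S
    by_cases hS0 : S = ∅
    · subst hS0
      exact ⟨0, fun U _ => Filter.Eventually.of_forall fun x h => absurd h Finset.not_nonempty_empty⟩
    by_cases hS2 : 2 ≤ S.card
    · obtain ⟨U₀, hU₀⟩ := h₃ k f hf S hS2 (δ / 2 ^ k) hδ'
      exact ⟨U₀, fun U hU => (hU₀ U hU).mono fun x hx _ => hx⟩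
    · have hS1 : S.card = 1 := by
        have := Finset.card_pos.2 (Finset.nonempty_iff_ne_empty.2 hS0)
        omega
      obtain ⟨i, rfl⟩ := Finset.card_eq_one.1 hS1
      by_cases hd : (f i).natDegree = 1
      · obtain ⟨U₀, hU₀⟩ := h₁ k f hf i hd (δ / 2 ^ k) hδ'
        refine ⟨U₀, fun U hU => (hU₀ U hU).mono fun x hx _ => ?_⟩
        simpa only [Finset.prod_singleton] using hx
      · have hd2 : 2 ≤ (f i).natDegree := by
          have := hf.natDegree_pos i
          omega
        obtain ⟨U₀, hU₀⟩ := h₂ k f hf i hd2 (δ / 2 ^ k) hδ'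
        refine ⟨U₀, fun U hU => (hU₀ U hU).mono fun x hx _ => ?_⟩
        simpa only [Finset.prod_singleton] using hx
  choose U₀ hU₀ using key
  refine ⟨Finset.univ.sup' Finset.univ_nonempty U₀, fun U hU => ?_⟩
  have hUS : ∀ S : Finset (Fin k), U₀ S ≤ U := fun S =>
    (Finset.le_sup' U₀ (Finset.mem_univ S)).trans hU
  have hev := Filter.eventually_all.2 fun S : Finset (Fin k) => hU₀ S U (hUS S)
  filter_upwards [hev] with x hx
  -- abbreviate the rough set and the sign
  set R : Finset ℕ := (Finset.Icc 1 x).filter (fun n : ℕ => ∀ i, 0 < (f i).eval (n : ℤ) ∧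
      ∀ p ∈ Finset.range ⌈(x : ℝ) ^ (((f i).natDegree : ℝ) / U)⌉₊,
        p.Prime → ¬ ((p : ℤ) ∣ (f i).eval (n : ℤ))) with hR
  -- Walsh
  have hW := walsh_allOdd R (fun (i : Fin k) (n : ℕ) => ArithmeticFunction.cardFactors (((f i).eval (n : ℤ)).toNat))
  simp only [Fintype.card_fin] at hW
  rw [hW, ← Finset.add_sum_erase _ _ (Finset.mem_univ (∅ : Finset (Fin k)))]
  simp only [Finset.card_empty, pow_zero, Finset.prod_empty, Finset.sum_const, nsmul_eq_mul, mul_one,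
    one_mul, add_sub_cancel_left]
  -- triangle inequality over the non-empty subsets
  have hcardR : (0 : ℝ) ≤ (R.card : ℝ) := Nat.cast_nonneg _
  calc |∑ S ∈ (Finset.univ : Finset (Finset (Fin k))).erase ∅,
          (-1 : ℝ) ^ S.card * ∑ n ∈ R, ∏ i ∈ S, (-1 : ℝ) ^ ArithmeticFunction.cardFactors (((f i).eval (n : ℤ)).toNat)|
      ≤ ∑ S ∈ (Finset.univ : Finset (Finset (Fin k))).erase ∅,
          |(-1 : ℝ) ^ S.card * ∑ n ∈ R, ∏ i ∈ S, (-1 : ℝ) ^ ArithmeticFunction.cardFactors (((f i).eval (n : ℤ)).toNat)| :=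
        Finset.abs_sum_le_sum_abs _ _
    _ ≤ ∑ S ∈ (Finset.univ : Finset (Finset (Fin k))).erase ∅, δ / 2 ^ k * (R.card : ℝ) := by
        refine Finset.sum_le_sum fun S hS => ?_
        have hSne : S.Nonempty := Finset.nonempty_iff_ne_empty.2 (Finset.ne_of_mem_erase hS)
        rw [abs_mul, abs_pow, abs_neg, abs_one, one_pow, one_mul]
        exact hx S hSne
    _ ≤ ∑ S ∈ (Finset.univ : Finset (Finset (Fin k))), δ / 2 ^ k * (R.card : ℝ) :=
        Finset.sum_le_sum_of_subset_of_nonneg (Finset.erase_subset _ _) fun _ _ _ => by positivity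
    _ = δ * (R.card : ℝ) := by
        rw [Finset.sum_const, Finset.card_univ, Fintype.card_finset, Fintype.card_fin, nsmul_eq_mul]
        push_cast
        field_simp

/-- **The line concludes the crux BY NAME** (the `#h21_check_skeleton` theorem): the three registered stubs,
fed to `roughParityBalance_of_parts`, give `Summit.Parity.BatemanHorn.Theses.RoughParitySectors.RoughParityBalance`.
No `sorry` of its own; its axiom closure contains `sorryAx` exactly through the three `stub_*`. -/
theorem RoughParityBalance_of : RoughParityBalance :=
  roughParityBalance_of_parts stub_linearMemberSign stub_nonlinearMemberSign stub_jointSignIndependence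

end Summit.Parity.BatemanHorn.Cruxes.RoughParityBalance.Birth
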